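/-
Copyright: the b2b-balaban T⁴-continuum CRUX team, row NE7b, leaf lineage `t4-ne7b-formalise-leaf-02` (gen 128). Project licence.
-/
import Summits.QuantumFields.BalabanUV.T4Continuum.Spine.NE7b.ConvexWindowSuppliers

/-!
# THE WINDOW IS A BOX: the third-derivative supplier of the convexity letter read in ANY size reading `N` — `‖D²P(y) − D²P(x)‖ ≤ c·N(y − x)`
# ON a convex `K`, modulus `2σ − (‖D²P(x₀)‖ + c·ρ)` on a window of `N`-size `ρ` about any centre `x₀` — and its SUP-NORM instance (row NE7b,
# node U5c; letter (ℓ1) of the windowed road; the refuter's located κ-ne7bref-g72-4 «ball radius vs cube» as kernel lemmas)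

Cell `pub-balaban`, sub-cell `t4`, spine estimate NE7b (`T4WeightBudget.RelWeightBound`; the cell's OWN estimate — NOT PRINTED in
[Bałaban 1983–89], NOT PROVED).  Crux-route work under `Spine/NE7b/` by the row's E-side ∕ key-readings leaf lineage; NOTHING of
Bałaban's is named or asserted; no `T4Continuum/Support` leaf typed; no `def`; zero `sorry`.

WHY.  `…NE7b.ConvexWindowSuppliers` §3 (OWNER, gen 107) supplies the modulus `λ = 2σ − (‖D²P(0)‖ + c₃ρ)` ON a window `K ⊆ B̄(0, ρ)` read in
the EUCLIDEAN norm, from `‖D³P‖ ≤ c₃` on `K`.  The refuter's located κ-ne7bref-g72-4 (PRICING-NE7b v86 F453): print's small-field window bounds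
every BOND VARIABLE (T-61: `K = L ∩ ⋂_b {|y_b| < a_b}`, per-bond balls cut by a linear subspace) in `n` directions, the smallest Euclidean ball
holding it has radius `ρ∞·√n`, and through §3 the modulus becomes `2σ − (‖D²P(0)‖ + c₃ρ∞√n)` — a factor `√n` (12.6–19.3 orders) worse than
the truth for a local perturbation (toy `P = cΣ_i y_i³`: `sup_K ‖D²P‖ = 6cρ∞` vs `6cρ∞√n`).  The located cure is the mixed-norm twin: ask
`‖D³P(z)[w, ·, ·]‖_op ≤ c∞·‖w‖_∞`, run the mean value inequality along the segment IN THAT NORM, read the window by its sup-norm half-width.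
THIS FILE types the twin ONCE for an ARBITRARY size reading `N : E → ℝ` of the direction slot (the mean value inequality along a segment sees
only the direction `y − x`, so `N` may be any real function: Euclidean norm, coordinate sup norm, per-bond block sup norm), about ANY centre
`x₀ ∈ K`, against the parent's §2 socket `firstOrderOn_quadratic_add_of_hessianOn`; then instantiates the readings.  Hypotheses ON `K` ONLY.

WHAT IS PROVED ([folklore] calculus on `E = EuclideanSpace ℝ (Fin n)`; the sup norm of `x` is `‖WithLp.ofLp x‖`, the norm of its
coordinate function `Fin n → ℝ`):
* §0 the box reading: `abs_apply_le_supNorm`, `supNorm_le_iff` (`‖x‖_∞ ≤ ρ ↔ ∀ i, |x i| ≤ ρ` for `0 ≤ ρ`), `supNorm_le_of_forall_abs_le`,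
  `supNorm_le_norm` (`‖x‖_∞ ≤ ‖x‖₂`), `norm_le_sqrt_mul_supNorm` (`‖x‖₂ ≤ √n·‖x‖_∞`), `subset_closedBall_of_supNorm_le` (a sup-norm window of
  half-width `ρ∞` lies in `B̄(0, √n·ρ∞)` — the refuter's `ρ_ball = ρ√n`).
* §1 ANY READING `N`: **`norm_hessian_sub_le_of_thirdDeriv_reading`** (`K` convex, `P ∈ C³`, `‖D³P(z)[w,·,·]‖_op ≤ c·N w` ON `K` ⟹
  `‖D²P(y) − D²P(x)‖ ≤ c·N(y − x)` for `x, y ∈ K`); `norm_hessian_le_of_thirdDeriv_reading` (`x₀ ∈ K`, `N(x − x₀) ≤ ρ` on `K`, `0 ≤ c` ⟹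
  `‖D²P(x)‖ ≤ ‖D²P(x₀)‖ + cρ`); `hessianOn_lower_of_thirdDeriv_reading` (`D²P(x)[v, v] ≥ −(‖D²P(x₀)‖ + cρ)‖v‖²`).
* §2 the END for any reading and centre, **`firstOrderOn_quadratic_add_of_thirdDeriv_reading`**: `A` symmetric `σ`-coercive ⟹ `⟪·, A·⟫ + P`
  has the road's first-order letter ON `K` with modulus `2σ − (‖D²P(x₀)‖ + cρ)`.
* §3 instances: **`firstOrderOn_quadratic_add_of_thirdDeriv_supNorm`** (the BOX: `0 ∈ K`, `‖x‖_∞ ≤ ρ∞` on `K`, mixed letter with `c∞` ⟹ modulus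
  `2σ − (‖D²P(0)‖ + c∞ρ∞)` — no `√n`), `…_supNorm_anharmonic` (`D²P(0) = 0`: `2σ − c∞ρ∞`), `…_supNorm_base` (any centre);
  `firstOrderOn_quadratic_add_of_thirdDeriv_norm_base` (the Euclidean reading about any centre `x₀`: `‖x − x₀‖ ≤ ρ` on `K`, `‖D³P‖ ≤ c₃` ON `K`
  ⟹ modulus `2σ − (‖D²P(x₀)‖ + c₃ρ)` — the parent's §3 END is the case `x₀ = 0`).
* §4 junctions: `thirdDeriv_reading_norm_of_norm_le` (`‖D³P‖ ≤ c₃` ON `K` ⟹ the Euclidean-reading letter with `c = c₃`),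
  `thirdDeriv_supNorm_of_norm_le` (⟹ the sup-norm letter with `c∞ = c₃·√n`: the twin is never worse than the parent's §3 on the enclosing ball,
  and better by `c∞ ∕ (c₃√n)` whenever the mixed constant is smaller), `thirdDeriv_supNorm_of_entries` (the coordinate-entry letter
  `|D³P(z)[w, u, v]| ≤ c∞‖w‖_∞‖u‖‖v‖` ⟹ the operator form; `thirdDeriv_reading_of_entries` the same for any reading `N ≥ 0`).
* §5 the model window (hypotheses inhabited): `convex_coordBox`, `supNorm_sub_le_of_mem_coordBox`, and
  **`firstOrderOn_quadratic_add_of_thirdDeriv_subspace_inter_coordBox`** — on `K = L ∩ {x | ∀ i, |x i − x₀ i| ≤ a}` (a linear subspace cut by a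
  coordinate box about `x₀ ∈ L`, T-61's shape coordinatewise) the modulus `2σ − (‖D²P(x₀)‖ + c∞a)` holds with convexity, centre and half-width
  DISCHARGED — only the three numbers `σ, c∞, a` remain displayed; `convex_blockWindow`, `norm_block_le_iSup`, `iSup_norm_block_le` and
  **`firstOrderOn_quadratic_add_of_thirdDeriv_subspace_inter_blockWindow`** — the same on T-61's window VERBATIM, `K = L ∩ ⋂_b {‖Q_b y‖ ≤ a}`
  (per-block balls cut by a subspace), read by the block sup norm `⨆_b ‖Q_b w‖`: modulus `2σ − (‖D²P(0)‖ + c·a)`, `a` the PER-BLOCK radius.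

NOT HERE (honest): the numbers `σ`, `c∞`, `ρ∞` for Bałaban's steps — (A3) readings, the by-value content of Q-ne7bref-g68-1; that the
bond-chart window is a coordinate (or per-bond) box of a stated half-width is a READING of print's small-field conditions (T-61's loci),
displayed by the consumer, not proved here; anything of Bałaban's.  NE7b NOT PRINTED ∕ NOT PROVED; spine PROVED 0∕9; rung (B)+1 on a FINITE
torus — NOT infinite volume, NOT the mass gap, NOT Clay.
HONEST DEPENDENCY: continuum YM on T⁴ ⇐ BetaPertH ∧ nine spine estimates (0/9 proved); BetaPertH ⇐ (D1) ∧ (D4) ∧ CAP+tail.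
-/

set_option autoImplicit false

noncomputable section

open Real InnerProductSpace Set Metric
open scoped RealInnerProductSpace Gradient
open Summit.QuantumFields.BalabanUV.T4Continuum.NE7b.ConvexWindowSuppliers

namespace Summit.QuantumFields.BalabanUV.T4Continuum.NE7b.ConvexWindowSuppliersBox

variable {n : ℕ}

/-! ## §0 The box reading: sup norm of the coordinates versus the Euclidean norm -/

/-- Each coordinate is bounded by the sup norm: `|x i| ≤ ‖x‖_∞`. [folklore] -/
theorem abs_apply_le_supNorm (x : EuclideanSpace ℝ (Fin n)) (i : Fin n) : |x i| ≤ ‖WithLp.ofLp x‖ := by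
  simpa [Real.norm_eq_abs] using norm_le_pi_norm (WithLp.ofLp x) i

/-- **THE BOX IS THE SUP-NORM BALL**: for `0 ≤ ρ`, `‖x‖_∞ ≤ ρ ↔ ∀ i, |x i| ≤ ρ`. [folklore] -/
theorem supNorm_le_iff {x : EuclideanSpace ℝ (Fin n)} {ρ : ℝ} (hρ : 0 ≤ ρ) :
    ‖WithLp.ofLp x‖ ≤ ρ ↔ ∀ i : Fin n, |x i| ≤ ρ := by
  rw [pi_norm_le_iff_of_nonneg hρ]
  simp only [Real.norm_eq_abs]

/-- The coordinate box of half-width `ρ ≥ 0` lies in the sup-norm ball of radius `ρ` (the direction consumers use). [folklore] -/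
theorem supNorm_le_of_forall_abs_le {x : EuclideanSpace ℝ (Fin n)} {ρ : ℝ} (hρ : 0 ≤ ρ) (h : ∀ i : Fin n, |x i| ≤ ρ) :
    ‖WithLp.ofLp x‖ ≤ ρ :=
  (supNorm_le_iff hρ).2 h

/-- `‖x‖_∞ ≤ ‖x‖₂`. [folklore] -/
theorem supNorm_le_norm (x : EuclideanSpace ℝ (Fin n)) : ‖WithLp.ofLp x‖ ≤ ‖x‖ :=
  (pi_norm_le_iff_of_nonneg (norm_nonneg x)).2 fun i => PiLp.norm_apply_le x i

/-- `‖x‖₂ ≤ √n · ‖x‖_∞`: the box of half-width `ρ∞` in `n` directions lies in the Euclidean ball of radius `√n·ρ∞` about its centre, and in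
no smaller one (the corner) — the refuter's «ρ_ball = ρ√n». [folklore] -/
theorem norm_le_sqrt_mul_supNorm (x : EuclideanSpace ℝ (Fin n)) : ‖x‖ ≤ √(n : ℝ) * ‖WithLp.ofLp x‖ := by
  have hsum : ∑ i : Fin n, ‖x i‖ ^ 2 ≤ (n : ℝ) * ‖WithLp.ofLp x‖ ^ 2 := by
    calc ∑ i : Fin n, ‖x i‖ ^ 2 ≤ ∑ _i : Fin n, ‖WithLp.ofLp x‖ ^ 2 :=
          Finset.sum_le_sum fun i _ => pow_le_pow_left₀ (norm_nonneg _) (norm_le_pi_norm (WithLp.ofLp x) i) 2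
      _ = (n : ℝ) * ‖WithLp.ofLp x‖ ^ 2 := by simp
  rw [EuclideanSpace.norm_eq x]
  calc √(∑ i : Fin n, ‖x i‖ ^ 2) ≤ √((n : ℝ) * ‖WithLp.ofLp x‖ ^ 2) := Real.sqrt_le_sqrt hsum
    _ = √(n : ℝ) * ‖WithLp.ofLp x‖ := by
        rw [Real.sqrt_mul (Nat.cast_nonneg n), Real.sqrt_sq (norm_nonneg _)]

/-- A sup-norm window of half-width `ρ∞` lies in the Euclidean ball `B̄(0, √n·ρ∞)`: the parent file's §3 CAN be run on a box, at the price
of the radius `√n·ρ∞`. [folklore] -/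
theorem subset_closedBall_of_supNorm_le {K : Set (EuclideanSpace ℝ (Fin n))} {ρ : ℝ}
    (hKρ : ∀ x ∈ K, ‖WithLp.ofLp x‖ ≤ ρ) :
    K ⊆ closedBall (0 : EuclideanSpace ℝ (Fin n)) (√(n : ℝ) * ρ) := fun x hx => by
  rw [mem_closedBall, dist_zero_right]
  exact (norm_le_sqrt_mul_supNorm x).trans (mul_le_mul_of_nonneg_left (hKρ x hx) (Real.sqrt_nonneg _))

/-! ## §1 The mean value inequality for the Hessian in an arbitrary size reading `N`, ON a convex window -/

/-- **MEAN VALUE FOR THE HESSIAN, ANY READING OF THE DIRECTION.**  `K` convex, `P ∈ C³`, `N : E → ℝ` any real function, and ON `K` the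
letter `‖D³P(z)[w, ·, ·]‖_op ≤ c·N(w)` (all directions `w`).  Then for `x, y ∈ K`: `‖D²P(y) − D²P(x)‖ ≤ c·N(y − x)` — the segment from `x` to
`y` stays in `K`, along it `τ ↦ D²P(x + τ(y − x))` has derivative `D³P(·)[y − x, ·, ·]`, and the mean value inequality on `[0, 1]` sees only
that one direction. [folklore] -/
theorem norm_hessian_sub_le_of_thirdDeriv_reading {P : EuclideanSpace ℝ (Fin n) → ℝ} (N : EuclideanSpace ℝ (Fin n) → ℝ) {c : ℝ}
    {K : Set (EuclideanSpace ℝ (Fin n))} (hK : Convex ℝ K) (hP : ContDiff ℝ 3 P)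
    (hP3 : ∀ z ∈ K, ∀ w : EuclideanSpace ℝ (Fin n), ‖fderiv ℝ (iteratedFDeriv ℝ 2 P) z w‖ ≤ c * N w)
    {x y : EuclideanSpace ℝ (Fin n)} (hx : x ∈ K) (hy : y ∈ K) :
    ‖iteratedFDeriv ℝ 2 P y - iteratedFDeriv ℝ 2 P x‖ ≤ c * N (y - x) := by
  have hd : Differentiable ℝ (iteratedFDeriv ℝ 2 P) := hP.differentiable_iteratedFDeriv (by norm_num)
  set ξ : EuclideanSpace ℝ (Fin n) := y - x with hξ
  have hseg : ∀ τ ∈ Icc (0 : ℝ) 1, x + τ • ξ ∈ K := fun τ hτ =>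
    hK.add_smul_mem hx (by rw [hξ, add_sub_cancel]; exact hy) hτ
  set g : ℝ → (EuclideanSpace ℝ (Fin n) [×2]→L[ℝ] ℝ) := fun τ => iteratedFDeriv ℝ 2 P (x + τ • ξ) with hg
  have hder : ∀ τ ∈ Icc (0 : ℝ) 1,
      HasDerivWithinAt g (fderiv ℝ (iteratedFDeriv ℝ 2 P) (x + τ • ξ) ξ) (Icc (0 : ℝ) 1) τ := fun τ _ =>
    ((hd (x + τ • ξ)).hasFDerivAt.comp_hasDerivAt τ
      (Literature.Analysis.Calculus.hasDerivAt_lineSegment x ξ τ)).hasDerivWithinAt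
  have hbound : ∀ τ ∈ Ico (0 : ℝ) 1, ‖fderiv ℝ (iteratedFDeriv ℝ 2 P) (x + τ • ξ) ξ‖ ≤ c * N ξ :=
    fun τ hτ => hP3 _ (hseg τ (Ico_subset_Icc_self hτ)) ξ
  have hmv := norm_image_sub_le_of_norm_deriv_le_segment_01' hder hbound
  have h1 : g 1 = iteratedFDeriv ℝ 2 P y := by simp [hg, hξ]
  rwa [h1, show g 0 = iteratedFDeriv ℝ 2 P x by simp [hg]] at hmv

/-- **THE HESSIAN ON A WINDOW OF `N`-SIZE `ρ` ABOUT A BASE POINT**: `K` convex, `x₀ ∈ K`, `N(x − x₀) ≤ ρ` on `K`; `P ∈ C³` with the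
`N`-letter ON `K`, `0 ≤ c` ⟹ `‖D²P(x)‖ ≤ ‖D²P(x₀)‖ + c·ρ` for `x ∈ K` (any centre `x₀` of the window — the two-centre form). [folklore] -/
theorem norm_hessian_le_of_thirdDeriv_reading {P : EuclideanSpace ℝ (Fin n) → ℝ} (N : EuclideanSpace ℝ (Fin n) → ℝ) {c ρ : ℝ}
    {K : Set (EuclideanSpace ℝ (Fin n))} (hK : Convex ℝ K) {x₀ : EuclideanSpace ℝ (Fin n)} (hx₀ : x₀ ∈ K)
    (hKρ : ∀ x ∈ K, N (x - x₀) ≤ ρ) (hP : ContDiff ℝ 3 P) (hc : 0 ≤ c)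
    (hP3 : ∀ z ∈ K, ∀ w : EuclideanSpace ℝ (Fin n), ‖fderiv ℝ (iteratedFDeriv ℝ 2 P) z w‖ ≤ c * N w)
    {x : EuclideanSpace ℝ (Fin n)} (hx : x ∈ K) :
    ‖iteratedFDeriv ℝ 2 P x‖ ≤ ‖iteratedFDeriv ℝ 2 P x₀‖ + c * ρ := by
  have hmv := norm_hessian_sub_le_of_thirdDeriv_reading N hK hP hP3 hx₀ hx
  calc ‖iteratedFDeriv ℝ 2 P x‖
        = ‖iteratedFDeriv ℝ 2 P x₀ + (iteratedFDeriv ℝ 2 P x - iteratedFDeriv ℝ 2 P x₀)‖ := by rw [add_sub_cancel]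
    _ ≤ ‖iteratedFDeriv ℝ 2 P x₀‖ + ‖iteratedFDeriv ℝ 2 P x - iteratedFDeriv ℝ 2 P x₀‖ := norm_add_le _ _
    _ ≤ ‖iteratedFDeriv ℝ 2 P x₀‖ + c * ρ := by
        refine add_le_add le_rfl (hmv.trans ?_)
        exact mul_le_mul_of_nonneg_left (hKρ x hx) hc

/-- **THE HESSIAN LOWER BOUND ON A WINDOW OF `N`-SIZE `ρ`**: under the hypotheses of `norm_hessian_le_of_thirdDeriv_reading`,
`D²P(x)[v, v] ≥ −(‖D²P(x₀)‖ + cρ)·‖v‖²` for `x ∈ K` (all `v`; `‖v‖` Euclidean — the socket's norm). [folklore] -/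
theorem hessianOn_lower_of_thirdDeriv_reading {P : EuclideanSpace ℝ (Fin n) → ℝ} (N : EuclideanSpace ℝ (Fin n) → ℝ) {c ρ : ℝ}
    {K : Set (EuclideanSpace ℝ (Fin n))} (hK : Convex ℝ K) {x₀ : EuclideanSpace ℝ (Fin n)} (hx₀ : x₀ ∈ K)
    (hKρ : ∀ x ∈ K, N (x - x₀) ≤ ρ) (hP : ContDiff ℝ 3 P) (hc : 0 ≤ c)
    (hP3 : ∀ z ∈ K, ∀ w : EuclideanSpace ℝ (Fin n), ‖fderiv ℝ (iteratedFDeriv ℝ 2 P) z w‖ ≤ c * N w) :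
    ∀ x ∈ K, ∀ v : EuclideanSpace ℝ (Fin n),
      -(‖iteratedFDeriv ℝ 2 P x₀‖ + c * ρ) * ‖v‖ ^ 2 ≤ iteratedFDeriv ℝ 2 P x ![v, v] := by
  intro x hx v
  have hn := norm_hessian_le_of_thirdDeriv_reading N hK hx₀ hKρ hP hc hP3 hx
  have hop := (iteratedFDeriv ℝ 2 P x).le_opNorm ![v, v]
  simp only [Fin.prod_univ_two, Matrix.cons_val_zero, Matrix.cons_val_one, Real.norm_eq_abs] at hop
  have h1 : |iteratedFDeriv ℝ 2 P x ![v, v]| ≤ (‖iteratedFDeriv ℝ 2 P x₀‖ + c * ρ) * ‖v‖ ^ 2 := by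
    calc |iteratedFDeriv ℝ 2 P x ![v, v]| ≤ ‖iteratedFDeriv ℝ 2 P x‖ * (‖v‖ * ‖v‖) := hop
      _ ≤ (‖iteratedFDeriv ℝ 2 P x₀‖ + c * ρ) * (‖v‖ * ‖v‖) := mul_le_mul_of_nonneg_right hn (by positivity)
      _ = (‖iteratedFDeriv ℝ 2 P x₀‖ + c * ρ) * ‖v‖ ^ 2 := by ring
  have h2 := (abs_le.1 h1).1
  linarith

/-! ## §2 The convexity letter on a window of `N`-size `ρ` from three primitive constants, any centre -/

/-- **THE CONVEXITY LETTER ON A WINDOW, ANY READING, ANY CENTRE.**  `K` convex, `x₀ ∈ K`, `N(x − x₀) ≤ ρ` on `K` for a size reading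
`N : E → ℝ`; `A` symmetric with `⟪v, Av⟫ ≥ σ‖v‖²`; `P ∈ C³` with `‖D³P(z)[w,·,·]‖_op ≤ c·N(w)` ON `K`, `0 ≤ c`.  Then `V = ⟪·, A·⟫ + P` satisfies
the road's first-order letter ON `K` with modulus `λ = 2σ − (‖D²P(x₀)‖ + cρ)`: the window's `N`-size times the `N`-read third-derivative constant
is the only loss against the Gaussian modulus. [folklore] -/
theorem firstOrderOn_quadratic_add_of_thirdDeriv_reading (A : EuclideanSpace ℝ (Fin n) →L[ℝ] EuclideanSpace ℝ (Fin n))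
    (N : EuclideanSpace ℝ (Fin n) → ℝ) {σ c ρ : ℝ} {K : Set (EuclideanSpace ℝ (Fin n))} (hK : Convex ℝ K)
    {x₀ : EuclideanSpace ℝ (Fin n)} (hx₀ : x₀ ∈ K) (hKρ : ∀ x ∈ K, N (x - x₀) ≤ ρ)
    (hA : ∀ v w : EuclideanSpace ℝ (Fin n), ⟪A v, w⟫ = ⟪v, A w⟫) (hσ : ∀ v : EuclideanSpace ℝ (Fin n), σ * ‖v‖ ^ 2 ≤ ⟪v, A v⟫)
    {P : EuclideanSpace ℝ (Fin n) → ℝ} (hP : ContDiff ℝ 3 P) (hc : 0 ≤ c)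
    (hP3 : ∀ z ∈ K, ∀ w : EuclideanSpace ℝ (Fin n), ‖fderiv ℝ (iteratedFDeriv ℝ 2 P) z w‖ ≤ c * N w) :
    ∀ x ∈ K, ∀ y ∈ K, (⟪x, A x⟫ + P x) + ⟪gradient (fun z : EuclideanSpace ℝ (Fin n) => ⟪z, A z⟫ + P z) x, y - x⟫ +
        (2 * σ - (‖iteratedFDeriv ℝ 2 P x₀‖ + c * ρ)) / 2 * ‖y - x‖ ^ 2 ≤ ⟪y, A y⟫ + P y :=
  firstOrderOn_quadratic_add_of_hessianOn A hK hA hσ (hP.of_le (by norm_num))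
    (hessianOn_lower_of_thirdDeriv_reading N hK hx₀ hKρ hP hc hP3)

/-! ## §3 Instances: the sup-norm box (the located letter) and the Euclidean reading about any centre -/

/-- **THE CONVEXITY LETTER ON A BOX WINDOW, ANY CENTRE** (`N = ‖·‖_∞`): `K` convex, `x₀ ∈ K`, `‖x − x₀‖_∞ ≤ ρ∞` on `K`; `A` symmetric
`σ`-coercive; `P ∈ C³` with the mixed letter `‖D³P(z)[w,·,·]‖_op ≤ c∞‖w‖_∞` ON `K`, `0 ≤ c∞` ⟹ modulus `2σ − (‖D²P(x₀)‖ + c∞ρ∞)` ON `K`. [folklore] -/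
theorem firstOrderOn_quadratic_add_of_thirdDeriv_supNorm_base (A : EuclideanSpace ℝ (Fin n) →L[ℝ] EuclideanSpace ℝ (Fin n))
    {σ c ρ : ℝ} {K : Set (EuclideanSpace ℝ (Fin n))} (hK : Convex ℝ K) {x₀ : EuclideanSpace ℝ (Fin n)} (hx₀ : x₀ ∈ K)
    (hKρ : ∀ x ∈ K, ‖WithLp.ofLp (x - x₀)‖ ≤ ρ)
    (hA : ∀ v w : EuclideanSpace ℝ (Fin n), ⟪A v, w⟫ = ⟪v, A w⟫) (hσ : ∀ v : EuclideanSpace ℝ (Fin n), σ * ‖v‖ ^ 2 ≤ ⟪v, A v⟫)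
    {P : EuclideanSpace ℝ (Fin n) → ℝ} (hP : ContDiff ℝ 3 P) (hc : 0 ≤ c)
    (hP3 : ∀ z ∈ K, ∀ w : EuclideanSpace ℝ (Fin n), ‖fderiv ℝ (iteratedFDeriv ℝ 2 P) z w‖ ≤ c * ‖WithLp.ofLp w‖) :
    ∀ x ∈ K, ∀ y ∈ K, (⟪x, A x⟫ + P x) + ⟪gradient (fun z : EuclideanSpace ℝ (Fin n) => ⟪z, A z⟫ + P z) x, y - x⟫ +
        (2 * σ - (‖iteratedFDeriv ℝ 2 P x₀‖ + c * ρ)) / 2 * ‖y - x‖ ^ 2 ≤ ⟪y, A y⟫ + P y :=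
  firstOrderOn_quadratic_add_of_thirdDeriv_reading A (fun w => ‖WithLp.ofLp w‖) hK hx₀ hKρ hA hσ hP hc hP3

/-- **THE CONVEXITY LETTER ON A BOX WINDOW** (centre `0`; the located κ-ne7bref-g72-4 verbatim).  `K` convex with `0 ∈ K` and sup-norm
half-width `ρ∞` (`‖x‖_∞ ≤ ρ∞` on `K`); `A` symmetric with `⟪v, Av⟫ ≥ σ‖v‖²`; `P ∈ C³` with the mixed letter `‖D³P(z)[w,·,·]‖_op ≤ c∞‖w‖_∞` ON `K`,
`0 ≤ c∞`.  Then `V = ⟪·, A·⟫ + P` satisfies the road's first-order letter ON `K` with modulus `λ = 2σ − (‖D²P(0)‖ + c∞ρ∞)`: the window's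
SUP-NORM half-width times the mixed third-derivative constant is the only loss against the Gaussian modulus — no factor `√n`. [folklore] -/
theorem firstOrderOn_quadratic_add_of_thirdDeriv_supNorm (A : EuclideanSpace ℝ (Fin n) →L[ℝ] EuclideanSpace ℝ (Fin n))
    {σ c ρ : ℝ} {K : Set (EuclideanSpace ℝ (Fin n))} (hK : Convex ℝ K) (h0 : (0 : EuclideanSpace ℝ (Fin n)) ∈ K)
    (hKρ : ∀ x ∈ K, ‖WithLp.ofLp x‖ ≤ ρ)
    (hA : ∀ v w : EuclideanSpace ℝ (Fin n), ⟪A v, w⟫ = ⟪v, A w⟫) (hσ : ∀ v : EuclideanSpace ℝ (Fin n), σ * ‖v‖ ^ 2 ≤ ⟪v, A v⟫)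
    {P : EuclideanSpace ℝ (Fin n) → ℝ} (hP : ContDiff ℝ 3 P) (hc : 0 ≤ c)
    (hP3 : ∀ z ∈ K, ∀ w : EuclideanSpace ℝ (Fin n), ‖fderiv ℝ (iteratedFDeriv ℝ 2 P) z w‖ ≤ c * ‖WithLp.ofLp w‖) :
    ∀ x ∈ K, ∀ y ∈ K, (⟪x, A x⟫ + P x) + ⟪gradient (fun z : EuclideanSpace ℝ (Fin n) => ⟪z, A z⟫ + P z) x, y - x⟫ +
        (2 * σ - (‖iteratedFDeriv ℝ 2 P 0‖ + c * ρ)) / 2 * ‖y - x‖ ^ 2 ≤ ⟪y, A y⟫ + P y :=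
  firstOrderOn_quadratic_add_of_thirdDeriv_supNorm_base A hK h0 (fun x hx => by simpa using hKρ x hx) hA hσ hP hc hP3

/-- The anharmonic case `D²P(0) = 0` on a box window: modulus `2σ − c∞ρ∞` ON `K`. [folklore] -/
theorem firstOrderOn_quadratic_add_of_thirdDeriv_supNorm_anharmonic
    (A : EuclideanSpace ℝ (Fin n) →L[ℝ] EuclideanSpace ℝ (Fin n)) {σ c ρ : ℝ} {K : Set (EuclideanSpace ℝ (Fin n))}
    (hK : Convex ℝ K) (h0 : (0 : EuclideanSpace ℝ (Fin n)) ∈ K) (hKρ : ∀ x ∈ K, ‖WithLp.ofLp x‖ ≤ ρ)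
    (hA : ∀ v w : EuclideanSpace ℝ (Fin n), ⟪A v, w⟫ = ⟪v, A w⟫) (hσ : ∀ v : EuclideanSpace ℝ (Fin n), σ * ‖v‖ ^ 2 ≤ ⟪v, A v⟫)
    {P : EuclideanSpace ℝ (Fin n) → ℝ} (hP : ContDiff ℝ 3 P) (hP2 : iteratedFDeriv ℝ 2 P 0 = 0) (hc : 0 ≤ c)
    (hP3 : ∀ z ∈ K, ∀ w : EuclideanSpace ℝ (Fin n), ‖fderiv ℝ (iteratedFDeriv ℝ 2 P) z w‖ ≤ c * ‖WithLp.ofLp w‖) :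
    ∀ x ∈ K, ∀ y ∈ K, (⟪x, A x⟫ + P x) + ⟪gradient (fun z : EuclideanSpace ℝ (Fin n) => ⟪z, A z⟫ + P z) x, y - x⟫ +
        (2 * σ - c * ρ) / 2 * ‖y - x‖ ^ 2 ≤ ⟪y, A y⟫ + P y := by
  have h := firstOrderOn_quadratic_add_of_thirdDeriv_supNorm A hK h0 hKρ hA hσ hP hc hP3
  rw [hP2, norm_zero, zero_add] at h
  exact h

/-- **THE EUCLIDEAN READING ABOUT ANY CENTRE** (`N = ‖·‖₂`; the parent's §3 END is the case `x₀ = 0`): `K` convex, `x₀ ∈ K`, `‖x − x₀‖ ≤ ρ` on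
`K`; `A` symmetric `σ`-coercive; `P ∈ C³` with `‖D³P(z)‖ ≤ c₃` ON `K` ⟹ modulus `2σ − (‖D²P(x₀)‖ + c₃ρ)` ON `K`. [folklore] -/
theorem firstOrderOn_quadratic_add_of_thirdDeriv_norm_base (A : EuclideanSpace ℝ (Fin n) →L[ℝ] EuclideanSpace ℝ (Fin n))
    {σ c₃ ρ : ℝ} {K : Set (EuclideanSpace ℝ (Fin n))} (hK : Convex ℝ K) {x₀ : EuclideanSpace ℝ (Fin n)} (hx₀ : x₀ ∈ K)
    (hKρ : ∀ x ∈ K, ‖x - x₀‖ ≤ ρ)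
    (hA : ∀ v w : EuclideanSpace ℝ (Fin n), ⟪A v, w⟫ = ⟪v, A w⟫) (hσ : ∀ v : EuclideanSpace ℝ (Fin n), σ * ‖v‖ ^ 2 ≤ ⟪v, A v⟫)
    {P : EuclideanSpace ℝ (Fin n) → ℝ} (hP : ContDiff ℝ 3 P) (hP3 : ∀ z ∈ K, ‖iteratedFDeriv ℝ 3 P z‖ ≤ c₃) :
    ∀ x ∈ K, ∀ y ∈ K, (⟪x, A x⟫ + P x) + ⟪gradient (fun z : EuclideanSpace ℝ (Fin n) => ⟪z, A z⟫ + P z) x, y - x⟫ +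
        (2 * σ - (‖iteratedFDeriv ℝ 2 P x₀‖ + c₃ * ρ)) / 2 * ‖y - x‖ ^ 2 ≤ ⟪y, A y⟫ + P y := by
  have hc₃ : 0 ≤ c₃ := (norm_nonneg _).trans (hP3 x₀ hx₀)
  refine firstOrderOn_quadratic_add_of_thirdDeriv_reading A (fun w => ‖w‖) hK hx₀ hKρ hA hσ hP hc₃ fun z hz w => ?_
  calc ‖fderiv ℝ (iteratedFDeriv ℝ 2 P) z w‖ ≤ ‖fderiv ℝ (iteratedFDeriv ℝ 2 P) z‖ * ‖w‖ :=
        (fderiv ℝ (iteratedFDeriv ℝ 2 P) z).le_opNorm w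
    _ ≤ c₃ * ‖w‖ := by
        rw [norm_fderiv_iteratedFDeriv]
        exact mul_le_mul_of_nonneg_right (hP3 z hz) (norm_nonneg _)

/-! ## §4 Junctions between the letters -/

/-- **THE OPERATOR-NORM LETTER IS A EUCLIDEAN-READING LETTER WITH `c = c₃`.**  `‖D³P(z)‖ ≤ c₃` for `z ∈ K` ⟹ `‖D³P(z)[w,·,·]‖_op ≤ c₃·‖w‖`.
[folklore] -/
theorem thirdDeriv_reading_norm_of_norm_le {P : EuclideanSpace ℝ (Fin n) → ℝ} {c₃ : ℝ} {K : Set (EuclideanSpace ℝ (Fin n))}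
    (hP3 : ∀ z ∈ K, ‖iteratedFDeriv ℝ 3 P z‖ ≤ c₃) :
    ∀ z ∈ K, ∀ w : EuclideanSpace ℝ (Fin n), ‖fderiv ℝ (iteratedFDeriv ℝ 2 P) z w‖ ≤ c₃ * ‖w‖ := by
  intro z hz w
  calc ‖fderiv ℝ (iteratedFDeriv ℝ 2 P) z w‖ ≤ ‖fderiv ℝ (iteratedFDeriv ℝ 2 P) z‖ * ‖w‖ :=
        (fderiv ℝ (iteratedFDeriv ℝ 2 P) z).le_opNorm w
    _ ≤ c₃ * ‖w‖ := by
        rw [norm_fderiv_iteratedFDeriv]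
        exact mul_le_mul_of_nonneg_right (hP3 z hz) (norm_nonneg _)

/-- **THE OPERATOR-NORM LETTER IS A SUP-NORM LETTER WITH `c∞ = c₃·√n`.**  `‖D³P(z)‖ ≤ c₃` for `z ∈ K` ⟹ `‖D³P(z)[w,·,·]‖_op ≤ (c₃·√n)·‖w‖_∞`.
Consequently the box END `firstOrderOn_quadratic_add_of_thirdDeriv_supNorm` fed with this letter returns `2σ − (‖D²P(0)‖ + c₃√n·ρ∞)`, which
is exactly the parent's §3 run on the enclosing ball `B̄(0, √n·ρ∞)` (`subset_closedBall_of_supNorm_le`): the twin is never worse, and it is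
better by the factor `c∞ ∕ (c₃√n)` whenever the mixed constant is smaller — the located `√n`. [folklore] -/
theorem thirdDeriv_supNorm_of_norm_le {P : EuclideanSpace ℝ (Fin n) → ℝ} {c₃ : ℝ} {K : Set (EuclideanSpace ℝ (Fin n))}
    (hP3 : ∀ z ∈ K, ‖iteratedFDeriv ℝ 3 P z‖ ≤ c₃) :
    ∀ z ∈ K, ∀ w : EuclideanSpace ℝ (Fin n),
      ‖fderiv ℝ (iteratedFDeriv ℝ 2 P) z w‖ ≤ (c₃ * √(n : ℝ)) * ‖WithLp.ofLp w‖ := by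
  intro z hz w
  have hc₃ : 0 ≤ c₃ := (norm_nonneg _).trans (hP3 z hz)
  calc ‖fderiv ℝ (iteratedFDeriv ℝ 2 P) z w‖ ≤ c₃ * ‖w‖ := thirdDeriv_reading_norm_of_norm_le hP3 z hz w
    _ ≤ c₃ * (√(n : ℝ) * ‖WithLp.ofLp w‖) := mul_le_mul_of_nonneg_left (norm_le_sqrt_mul_supNorm w) hc₃
    _ = (c₃ * √(n : ℝ)) * ‖WithLp.ofLp w‖ := by ring

/-- **THE ENTRY LETTER GIVES THE OPERATOR LETTER, ANY READING.**  If `|D³P(z)[w, u, v]| ≤ c·N(w)·‖u‖·‖v‖` for `z ∈ K` and all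
`w, u, v` (`0 ≤ c`, `0 ≤ N`), then `‖D³P(z)[w,·,·]‖_op ≤ c·N(w)` — the form §1–§3 consume. [folklore] -/
theorem thirdDeriv_reading_of_entries {P : EuclideanSpace ℝ (Fin n) → ℝ} (N : EuclideanSpace ℝ (Fin n) → ℝ) {c : ℝ}
    {K : Set (EuclideanSpace ℝ (Fin n))} (hN : ∀ w, 0 ≤ N w) (hc : 0 ≤ c)
    (hP3 : ∀ z ∈ K, ∀ w u v : EuclideanSpace ℝ (Fin n),
      |iteratedFDeriv ℝ 3 P z ![w, u, v]| ≤ c * N w * ‖u‖ * ‖v‖) :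
    ∀ z ∈ K, ∀ w : EuclideanSpace ℝ (Fin n),
      ‖fderiv ℝ (iteratedFDeriv ℝ 2 P) z w‖ ≤ c * N w := by
  intro z hz w
  refine ContinuousMultilinearMap.opNorm_le_bound (mul_nonneg hc (hN w)) fun m => ?_
  have happ : fderiv ℝ (iteratedFDeriv ℝ 2 P) z w m = iteratedFDeriv ℝ 3 P z (Fin.cons w m) := by
    rw [iteratedFDeriv_succ_apply_left]
    simp only [Fin.cons_zero, Fin.tail_cons]
  have hm : Fin.cons w m = ![w, m 0, m 1] := by
    ext i : 1
    refine Fin.cases ?_ (fun j => ?_) i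
    · simp
    · simp only [Fin.cons_succ, Matrix.cons_val_succ]
      refine Fin.cases ?_ (fun k => ?_) j
      · simp
      · simp only [Matrix.cons_val_succ, Fin.fin_one_eq_zero k, Matrix.cons_val_fin_one]
        rfl
  rw [happ, hm, Real.norm_eq_abs, Fin.prod_univ_two]
  have h := hP3 z hz w (m 0) (m 1)
  calc |iteratedFDeriv ℝ 3 P z ![w, m 0, m 1]| ≤ c * N w * ‖m 0‖ * ‖m 1‖ := h
    _ = c * N w * (‖m 0‖ * ‖m 1‖) := by ring

/-- **THE COORDINATE-ENTRY LETTER GIVES THE OPERATOR LETTER** (sup-norm reading).  If `|D³P(z)[w, u, v]| ≤ c∞·‖w‖_∞·‖u‖·‖v‖` for `z ∈ K`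
and all `w, u, v` (`0 ≤ c∞`), then `‖D³P(z)[w,·,·]‖_op ≤ c∞·‖w‖_∞`. [folklore] -/
theorem thirdDeriv_supNorm_of_entries {P : EuclideanSpace ℝ (Fin n) → ℝ} {c : ℝ} {K : Set (EuclideanSpace ℝ (Fin n))}
    (hc : 0 ≤ c)
    (hP3 : ∀ z ∈ K, ∀ w u v : EuclideanSpace ℝ (Fin n),
      |iteratedFDeriv ℝ 3 P z ![w, u, v]| ≤ c * ‖WithLp.ofLp w‖ * ‖u‖ * ‖v‖) :
    ∀ z ∈ K, ∀ w : EuclideanSpace ℝ (Fin n),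
      ‖fderiv ℝ (iteratedFDeriv ℝ 2 P) z w‖ ≤ c * ‖WithLp.ofLp w‖ :=
  thirdDeriv_reading_of_entries (fun w => ‖WithLp.ofLp w‖) (fun _ => norm_nonneg _) hc hP3

/-! ## §5 The model window: a coordinate box cut by a linear subspace (the hypotheses inhabited) -/

/-- **A COORDINATE BOX IS CONVEX**: `{x | ∀ i, |x i − x₀ i| ≤ a}` is convex (an intersection of coordinate slabs). [folklore] -/
theorem convex_coordBox (x₀ : EuclideanSpace ℝ (Fin n)) (a : ℝ) :
    Convex ℝ {x : EuclideanSpace ℝ (Fin n) | ∀ i : Fin n, |x i - x₀ i| ≤ a} := by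
  have h : {x : EuclideanSpace ℝ (Fin n) | ∀ i : Fin n, |x i - x₀ i| ≤ a} =
      ⋂ i : Fin n, ({x : EuclideanSpace ℝ (Fin n) | x i ≤ x₀ i + a} ∩ {x : EuclideanSpace ℝ (Fin n) | x₀ i - a ≤ x i}) := by
    ext x
    simp only [mem_setOf_eq, mem_iInter, mem_inter_iff, abs_le]
    refine forall_congr' fun i => ⟨fun h => ⟨?_, ?_⟩, fun h => ⟨?_, ?_⟩⟩ <;> linarith [h.1, h.2]
  rw [h]
  refine convex_iInter fun i => ?_
  have hl : IsLinearMap ℝ fun x : EuclideanSpace ℝ (Fin n) => x i := ⟨fun x y => rfl, fun c x => rfl⟩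
  exact (convex_halfSpace_le hl _).inter (convex_halfSpace_ge hl _)

/-- On the coordinate box of half-width `a ≥ 0` about `x₀`, the sup-norm distance to the centre is at most `a`. [folklore] -/
theorem supNorm_sub_le_of_mem_coordBox {x₀ x : EuclideanSpace ℝ (Fin n)} {a : ℝ} (ha : 0 ≤ a)
    (hx : ∀ i : Fin n, |x i - x₀ i| ≤ a) : ‖WithLp.ofLp (x - x₀)‖ ≤ a :=
  supNorm_le_of_forall_abs_le ha fun i => by simpa using hx i

/-- **THE CONVEXITY LETTER ON THE MODEL WINDOW `K = L ∩ box(x₀, a)`** — a linear subspace `L` (the constraint surface of the chart) cut by the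
coordinate box of half-width `a ≥ 0` about a point `x₀ ∈ L` (T-61's shape, coordinatewise): `A` symmetric `σ`-coercive, `P ∈ C³` with the mixed
letter `‖D³P(z)[w,·,·]‖_op ≤ c∞‖w‖_∞` ON `K`, `0 ≤ c∞` ⟹ modulus `2σ − (‖D²P(x₀)‖ + c∞·a)` ON `K`.  Every structural hypothesis of §2–§3
(convexity, centre in the window, sup-norm half-width) is DISCHARGED here; only the three numbers remain. [folklore] -/
theorem firstOrderOn_quadratic_add_of_thirdDeriv_subspace_inter_coordBox
    (A : EuclideanSpace ℝ (Fin n) →L[ℝ] EuclideanSpace ℝ (Fin n)) (L : Submodule ℝ (EuclideanSpace ℝ (Fin n)))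
    {x₀ : EuclideanSpace ℝ (Fin n)} (hx₀ : x₀ ∈ L) {a σ c : ℝ} (ha : 0 ≤ a)
    (hA : ∀ v w : EuclideanSpace ℝ (Fin n), ⟪A v, w⟫ = ⟪v, A w⟫) (hσ : ∀ v : EuclideanSpace ℝ (Fin n), σ * ‖v‖ ^ 2 ≤ ⟪v, A v⟫)
    {P : EuclideanSpace ℝ (Fin n) → ℝ} (hP : ContDiff ℝ 3 P) (hc : 0 ≤ c)
    (hP3 : ∀ z ∈ (L : Set (EuclideanSpace ℝ (Fin n))) ∩ {x | ∀ i : Fin n, |x i - x₀ i| ≤ a},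
      ∀ w : EuclideanSpace ℝ (Fin n), ‖fderiv ℝ (iteratedFDeriv ℝ 2 P) z w‖ ≤ c * ‖WithLp.ofLp w‖) :
    ∀ x ∈ (L : Set (EuclideanSpace ℝ (Fin n))) ∩ {x | ∀ i : Fin n, |x i - x₀ i| ≤ a},
      ∀ y ∈ (L : Set (EuclideanSpace ℝ (Fin n))) ∩ {x | ∀ i : Fin n, |x i - x₀ i| ≤ a},
        (⟪x, A x⟫ + P x) + ⟪gradient (fun z : EuclideanSpace ℝ (Fin n) => ⟪z, A z⟫ + P z) x, y - x⟫ +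
          (2 * σ - (‖iteratedFDeriv ℝ 2 P x₀‖ + c * a)) / 2 * ‖y - x‖ ^ 2 ≤ ⟪y, A y⟫ + P y :=
  firstOrderOn_quadratic_add_of_thirdDeriv_supNorm_base A ((L.convex).inter (convex_coordBox x₀ a))
    ⟨hx₀, fun i => by simpa using ha⟩ (fun x hx => supNorm_sub_le_of_mem_coordBox ha hx.2) hA hσ hP hc hP3

/-- **A PER-BLOCK WINDOW IS CONVEX**: `{y | ∀ b, ‖Q_b y‖ ≤ a}` (T-61's `⋂_b {|y_b| ≤ a_b}` with `Q_b` the block maps) is convex — an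
intersection of preimages of a ball under linear maps. [folklore] -/
theorem convex_blockWindow {B : Type*} (Q : B → EuclideanSpace ℝ (Fin n) →L[ℝ] EuclideanSpace ℝ (Fin n)) (a : ℝ) :
    Convex ℝ {y : EuclideanSpace ℝ (Fin n) | ∀ b, ‖Q b y‖ ≤ a} := by
  have h : {y : EuclideanSpace ℝ (Fin n) | ∀ b, ‖Q b y‖ ≤ a} = ⋂ b, (Q b) ⁻¹' closedBall 0 a := by ext y; simp
  rw [h]
  exact convex_iInter fun b => (convex_closedBall _ _).linear_preimage (Q b).toLinearMap

/-- Each block norm is at most the block sup norm `⨆_b ‖Q_b w‖` (finitely many blocks). [folklore] -/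
theorem norm_block_le_iSup {B : Type*} [Finite B] (Q : B → EuclideanSpace ℝ (Fin n) →L[ℝ] EuclideanSpace ℝ (Fin n))
    (w : EuclideanSpace ℝ (Fin n)) (b : B) : ‖Q b w‖ ≤ ⨆ b', ‖Q b' w‖ :=
  le_ciSup (Set.finite_range fun b' => ‖Q b' w‖).bddAbove b

/-- The block sup norm is at most `a` once every block norm is (at least one block). [folklore] -/
theorem iSup_norm_block_le {B : Type*} [Nonempty B] (Q : B → EuclideanSpace ℝ (Fin n) →L[ℝ] EuclideanSpace ℝ (Fin n))
    {w : EuclideanSpace ℝ (Fin n)} {a : ℝ} (h : ∀ b, ‖Q b w‖ ≤ a) : (⨆ b, ‖Q b w‖) ≤ a :=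
  ciSup_le h

/-- **THE CONVEXITY LETTER ON T-61's WINDOW `K = L ∩ ⋂_b {‖Q_b y‖ ≤ a}`** (per-block balls of radius `a ≥ 0` cut by a linear subspace `L` —
print's small-field window in the bond chart, read by the block sup norm `N w = ⨆_b ‖Q_b w‖`): `A` symmetric `σ`-coercive, `P ∈ C³` with the
block-read letter `‖D³P(z)[w,·,·]‖_op ≤ c·⨆_b ‖Q_b w‖` ON `K`, `0 ≤ c` ⟹ modulus `2σ − (‖D²P(0)‖ + c·a)` ON `K` — the PER-BLOCK radius `a`, no
`√n`, no block-dimension factor; convexity, centre, reading discharged. [folklore] -/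
theorem firstOrderOn_quadratic_add_of_thirdDeriv_subspace_inter_blockWindow {B : Type*} [Finite B] [Nonempty B]
    (A : EuclideanSpace ℝ (Fin n) →L[ℝ] EuclideanSpace ℝ (Fin n)) (Q : B → EuclideanSpace ℝ (Fin n) →L[ℝ] EuclideanSpace ℝ (Fin n))
    (L : Submodule ℝ (EuclideanSpace ℝ (Fin n))) {a σ c : ℝ} (ha : 0 ≤ a)
    (hA : ∀ v w : EuclideanSpace ℝ (Fin n), ⟪A v, w⟫ = ⟪v, A w⟫) (hσ : ∀ v : EuclideanSpace ℝ (Fin n), σ * ‖v‖ ^ 2 ≤ ⟪v, A v⟫)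
    {P : EuclideanSpace ℝ (Fin n) → ℝ} (hP : ContDiff ℝ 3 P) (hc : 0 ≤ c)
    (hP3 : ∀ z ∈ (L : Set (EuclideanSpace ℝ (Fin n))) ∩ {y | ∀ b, ‖Q b y‖ ≤ a},
      ∀ w : EuclideanSpace ℝ (Fin n), ‖fderiv ℝ (iteratedFDeriv ℝ 2 P) z w‖ ≤ c * ⨆ b, ‖Q b w‖) :
    ∀ x ∈ (L : Set (EuclideanSpace ℝ (Fin n))) ∩ {y | ∀ b, ‖Q b y‖ ≤ a},
      ∀ y ∈ (L : Set (EuclideanSpace ℝ (Fin n))) ∩ {y | ∀ b, ‖Q b y‖ ≤ a},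
        (⟪x, A x⟫ + P x) + ⟪gradient (fun z : EuclideanSpace ℝ (Fin n) => ⟪z, A z⟫ + P z) x, y - x⟫ +
          (2 * σ - (‖iteratedFDeriv ℝ 2 P 0‖ + c * a)) / 2 * ‖y - x‖ ^ 2 ≤ ⟪y, A y⟫ + P y :=
  firstOrderOn_quadratic_add_of_thirdDeriv_reading A (fun w => ⨆ b, ‖Q b w‖) ((L.convex).inter (convex_blockWindow Q a))
    ⟨L.zero_mem, fun b => by simpa using ha⟩ (fun y hy => by simpa using iSup_norm_block_le Q hy.2) hA hσ hP hc hP3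

end Summit.QuantumFields.BalabanUV.T4Continuum.NE7b.ConvexWindowSuppliersBox

end
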